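import Literature.AlgebraicGeometry.Motives.IntegralModelReductionMapAbelianScheme
import HarnessLib

/-!
# Points of the special fibre of a product model are pairs; the reduction of a pair is the pair of reductions
# ([SerreTate1968] §1; [GortzWedhorn2020] (4.7) base change commutes with fibre products)

Topic `Literature/AlgebraicGeometry/Motives`.  THEOREMS only (no def, no instance, no notation, no named fact, no `sorry`).  Cell
`hodgecm-mathlib` (D-0151), FLOOR 0, programme F0P5a (D9op road 2′, crux item stmt-HodgeConjecture-24832): the «pairs» bookkeeping of the ED4
composition (§8 steps 5–7: points `(a, b)` of `(𝒮 ⊗ 𝒮)_w(κ̄)` formed from two points of `𝒮_w(κ̄)`, and `red_{𝒮⊗𝒮}(x, y) = (red_𝒮 x, red_𝒮 y)`).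

§1 (any monoidal functor `F` between cartesian monoidal categories, e.g. the special-fibre functor `Over.pullback`): a morphism
`z : T ⟶ F(A ⊗ B)` is determined by `z ≫ F(fst)` and `z ≫ F(snd)` (`hom_ext_map_fst_map_snd`), and is the «pair»
`lift (z ≫ F fst) (z ≫ F snd) ≫ μ_F` (`eq_lift_comp_μ`); the pair `lift a b ≫ μ_F` has components `a`, `b`.
§2 (proper integral models `𝒳`, `𝒴` at a finite place `v` of a number field; `Ω = \overline{K_v}`): the components of `red_{𝒳⊗𝒴} x` are
`red_𝒳 (x ≫ fst)`, `red_𝒴 (x ≫ snd)` (★ `IntegralModel.geomReductionMap_map` at ★ `map_fst_comp_genericIso_hom` / `map_snd_comp_genericIso_hom`),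
hence **`geomReductionMap_tensor_lift`**: `red_{𝒳⊗𝒴} (lift x₁ x₂) = lift (red_𝒳 x₁) (red_𝒴 x₂) ≫ μ`.

HC_CM is proved only modulo the 7 printed citations until rung 0 closes; this file is a generic leaf and changes no count.

## References
* [SerreTate1968] J.-P. Serre, J. Tate, *Good reduction of abelian varieties*, Ann. of Math. 88 (1968), §1.
* [GortzWedhorn2020] U. Görtz, T. Wedhorn, *Algebraic Geometry I* (2nd ed.), Section (4.7) (fibre products and base change).
-/

set_option autoImplicit false

noncomputable section

universe v₁ v₂ u₁ u₂

open CategoryTheory CategoryTheory.Limits MonoidalCategory CartesianMonoidalCategory AlgebraicGeometry IsDedekindDomain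
  IsDedekindDomain.HeightOneSpectrum
open scoped NumberField
open Literature.NumberTheory.EllipticCurves (genericFibre)
open Literature.NumberTheory.GaloisRepresentations (closureValuationSubring)
open Literature.NumberTheory.DiophantineGeometry

namespace Literature.AlgebraicGeometry.Motives

/-! ### §1 Morphisms into `F(A ⊗ B)` for a monoidal functor between cartesian monoidal categories -/

namespace CartesianMonoidal

variable {C : Type u₁} [Category.{v₁} C] [CartesianMonoidalCategory C] {D : Type u₂} [Category.{v₂} D] [CartesianMonoidalCategory D]
  (F : C ⥤ D) [F.Monoidal] {T : D} {A B : C}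

/-- The «pair» `lift a b ≫ μ_F : T ⟶ F(A ⊗ B)` has first component `a`. [cite: GortzWedhorn2020, Section (4.7)] -/
theorem lift_comp_μ_comp_map_fst (a : T ⟶ F.obj A) (b : T ⟶ F.obj B) :
    (lift a b ≫ Functor.LaxMonoidal.μ F A B) ≫ F.map (fst A B) = a := by
  rw [Category.assoc, Functor.Monoidal.μ_fst, lift_fst]

/-- The «pair» `lift a b ≫ μ_F : T ⟶ F(A ⊗ B)` has second component `b`. [cite: GortzWedhorn2020, Section (4.7)] -/
theorem lift_comp_μ_comp_map_snd (a : T ⟶ F.obj A) (b : T ⟶ F.obj B) :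
    (lift a b ≫ Functor.LaxMonoidal.μ F A B) ≫ F.map (snd A B) = b := by
  rw [Category.assoc, Functor.Monoidal.μ_snd, lift_snd]

/-- **A morphism into `F(A ⊗ B)` is determined by its two components** `z ≫ F(fst)`, `z ≫ F(snd)` (`F` monoidal, so `F(A ⊗ B) ≅ F A ⊗ F B`).
[cite: GortzWedhorn2020, Section (4.7)] -/
theorem hom_ext_map_fst_map_snd (z z' : T ⟶ F.obj (A ⊗ B)) (h₁ : z ≫ F.map (fst A B) = z' ≫ F.map (fst A B))
    (h₂ : z ≫ F.map (snd A B) = z' ≫ F.map (snd A B)) : z = z' := by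
  rw [← cancel_mono (Functor.Monoidal.μIso F A B).inv, Functor.Monoidal.μIso_inv]
  apply CartesianMonoidalCategory.hom_ext
  · rw [Category.assoc, Category.assoc, Functor.OplaxMonoidal.δ_fst, h₁]
  · rw [Category.assoc, Category.assoc, Functor.OplaxMonoidal.δ_snd, h₂]

/-- **Every morphism into `F(A ⊗ B)` is the pair of its components**: `z = lift (z ≫ F fst) (z ≫ F snd) ≫ μ_F`.
[cite: GortzWedhorn2020, Section (4.7)] -/
theorem eq_lift_comp_μ (z : T ⟶ F.obj (A ⊗ B)) :
    z = lift (z ≫ F.map (fst A B)) (z ≫ F.map (snd A B)) ≫ Functor.LaxMonoidal.μ F A B :=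
  hom_ext_map_fst_map_snd F _ _ (by rw [lift_comp_μ_comp_map_fst]) (by rw [lift_comp_μ_comp_map_snd])

/-- Two pairs are equal iff their components are. [cite: GortzWedhorn2020, Section (4.7)] -/
theorem lift_comp_μ_eq_lift_comp_μ_iff (a a' : T ⟶ F.obj A) (b b' : T ⟶ F.obj B) :
    lift a b ≫ Functor.LaxMonoidal.μ F A B = lift a' b' ≫ Functor.LaxMonoidal.μ F A B ↔ a = a' ∧ b = b' := by
  constructor
  · intro h
    exact ⟨by rw [← lift_comp_μ_comp_map_fst F a b, h, lift_comp_μ_comp_map_fst],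
      by rw [← lift_comp_μ_comp_map_snd F a b, h, lift_comp_μ_comp_map_snd]⟩
  · rintro ⟨rfl, rfl⟩; rfl

/-- `F` applied to a pair downstairs is the pair upstairs: `F (lift f g) = lift (F f) (F g) ≫ μ_F` (Mathlib `Functor.Monoidal.lift_μ`).
[cite: GortzWedhorn2020, Section (4.7)] -/
theorem map_lift_eq_lift_comp_μ {S : C} (f : S ⟶ A) (g : S ⟶ B) :
    F.map (lift f g) = lift (F.map f) (F.map g) ≫ Functor.LaxMonoidal.μ F A B :=
  (Functor.Monoidal.lift_μ F f g).symm

end CartesianMonoidal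

/-! ### §2 The reduction of a pair is the pair of reductions -/

namespace IntegralModel

variable {K : Type} [Field K] [NumberField K] {v : HeightOneSpectrum (𝓞 K)} {X Y : SchemeOver K}

/-- **First component of the reduction of a point of `X ⊗ Y`**: `red_{𝒳⊗𝒴} x ≫ (fst)_v = red_𝒳 (x ≫ fst)` ([SerreTate1968] §1; ★
`geomReductionMap_map` at the first projection of the product model, ★ `map_fst_comp_genericIso_hom`). [cite: SerreTate1968, §1] -/
theorem map_fst_geomReductionMap_tensor (𝒳 : IntegralModel (valuationSubringAtPrime K v) K X)
    (𝒴 : IntegralModel (valuationSubringAtPrime K v) K Y) [IsProper 𝒳.total.hom] [IsProper 𝒴.total.hom]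
    (x : AlgPoints (X ⊗ Y) (AlgebraicClosure (v.adicCompletion K))) :
    AlgPoints.map ((specialFibreFunctor v).map (fst 𝒳.total 𝒴.total))
        (haveI := isProper_tensor_total 𝒳 𝒴; (𝒳.tensor 𝒴).geomReductionMap x) =
      𝒳.geomReductionMap (AlgPoints.map (fst X Y) x) := by
  haveI := isProper_tensor_total 𝒳 𝒴
  exact (geomReductionMap_map (𝒳.tensor 𝒴) 𝒳 (fst 𝒳.total 𝒴.total) (fst X Y) (map_fst_comp_genericIso_hom 𝒳 𝒴) x).symm

/-- **Second component of the reduction of a point of `X ⊗ Y`**: `red_{𝒳⊗𝒴} x ≫ (snd)_v = red_𝒴 (x ≫ snd)`. [cite: SerreTate1968, §1] -/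
theorem map_snd_geomReductionMap_tensor (𝒳 : IntegralModel (valuationSubringAtPrime K v) K X)
    (𝒴 : IntegralModel (valuationSubringAtPrime K v) K Y) [IsProper 𝒳.total.hom] [IsProper 𝒴.total.hom]
    (x : AlgPoints (X ⊗ Y) (AlgebraicClosure (v.adicCompletion K))) :
    AlgPoints.map ((specialFibreFunctor v).map (snd 𝒳.total 𝒴.total))
        (haveI := isProper_tensor_total 𝒳 𝒴; (𝒳.tensor 𝒴).geomReductionMap x) =
      𝒴.geomReductionMap (AlgPoints.map (snd X Y) x) := by
  haveI := isProper_tensor_total 𝒳 𝒴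
  exact (geomReductionMap_map (𝒳.tensor 𝒴) 𝒴 (snd 𝒳.total 𝒴.total) (snd X Y) (map_snd_comp_genericIso_hom 𝒳 𝒴) x).symm

/-- **The reduction of a point of `X ⊗ Y` is the pair of the reductions of its components**:
`red_{𝒳⊗𝒴} x = lift (red_𝒳 (x ≫ fst)) (red_𝒴 (x ≫ snd)) ≫ μ_v` (`μ_v` the tensorator of the special-fibre functor).
[cite: SerreTate1968, §1] [cite: GortzWedhorn2020, Section (4.7)] -/
theorem geomReductionMap_tensor_eq_lift (𝒳 : IntegralModel (valuationSubringAtPrime K v) K X)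
    (𝒴 : IntegralModel (valuationSubringAtPrime K v) K Y) [IsProper 𝒳.total.hom] [IsProper 𝒴.total.hom]
    (x : AlgPoints (X ⊗ Y) (AlgebraicClosure (v.adicCompletion K))) :
    (haveI := isProper_tensor_total 𝒳 𝒴; (𝒳.tensor 𝒴).geomReductionMap x) =
      lift (𝒳.geomReductionMap (AlgPoints.map (fst X Y) x)) (𝒴.geomReductionMap (AlgPoints.map (snd X Y) x)) ≫
        Functor.LaxMonoidal.μ (specialFibreFunctor v) 𝒳.total 𝒴.total := by
  rw [← map_fst_geomReductionMap_tensor 𝒳 𝒴 x, ← map_snd_geomReductionMap_tensor 𝒳 𝒴 x, AlgPoints.map_apply, AlgPoints.map_apply]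
  exact CartesianMonoidal.eq_lift_comp_μ (specialFibreFunctor v) _

/-- **The reduction of a pair is the pair of reductions**: `red_{𝒳⊗𝒴} (x₁, x₂) = (red_𝒳 x₁, red_𝒴 x₂)`, i.e.
`red_{𝒳⊗𝒴} (lift x₁ x₂) = lift (red_𝒳 x₁) (red_𝒴 x₂) ≫ μ_v` — ED4 §8 step 5. [cite: SerreTate1968, §1] [cite: GortzWedhorn2020, Section (4.7)] -/
theorem geomReductionMap_tensor_lift (𝒳 : IntegralModel (valuationSubringAtPrime K v) K X)
    (𝒴 : IntegralModel (valuationSubringAtPrime K v) K Y) [IsProper 𝒳.total.hom] [IsProper 𝒴.total.hom]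
    (x₁ : AlgPoints X (AlgebraicClosure (v.adicCompletion K))) (x₂ : AlgPoints Y (AlgebraicClosure (v.adicCompletion K))) :
    (haveI := isProper_tensor_total 𝒳 𝒴; (𝒳.tensor 𝒴).geomReductionMap (lift x₁ x₂)) =
      lift (𝒳.geomReductionMap x₁) (𝒴.geomReductionMap x₂) ≫ Functor.LaxMonoidal.μ (specialFibreFunctor v) 𝒳.total 𝒴.total := by
  rw [geomReductionMap_tensor_eq_lift, AlgPoints.map_apply, AlgPoints.map_apply, lift_fst, lift_snd]

/-- Two points of `X ⊗ Y` with the same component reductions have the same reduction. [cite: SerreTate1968, §1] -/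
theorem geomReductionMap_tensor_eq_of_components (𝒳 : IntegralModel (valuationSubringAtPrime K v) K X)
    (𝒴 : IntegralModel (valuationSubringAtPrime K v) K Y) [IsProper 𝒳.total.hom] [IsProper 𝒴.total.hom]
    (x x' : AlgPoints (X ⊗ Y) (AlgebraicClosure (v.adicCompletion K)))
    (h₁ : 𝒳.geomReductionMap (AlgPoints.map (fst X Y) x) = 𝒳.geomReductionMap (AlgPoints.map (fst X Y) x'))
    (h₂ : 𝒴.geomReductionMap (AlgPoints.map (snd X Y) x) = 𝒴.geomReductionMap (AlgPoints.map (snd X Y) x')) :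
    (haveI := isProper_tensor_total 𝒳 𝒴; (𝒳.tensor 𝒴).geomReductionMap x) =
      (haveI := isProper_tensor_total 𝒳 𝒴; (𝒳.tensor 𝒴).geomReductionMap x') := by
  rw [geomReductionMap_tensor_eq_lift, geomReductionMap_tensor_eq_lift, h₁, h₂]

/-- **Surjectivity of `red_{𝒳⊗𝒴}` from surjectivity of the factors** (row H for a product from row H for the factors: a `κ̄`-point of
`(𝒳 ⊗ 𝒴)_v` is a pair, lift each component). [cite: SerreTate1968, §1] [cite: GortzWedhorn2020, Section (4.7)] -/
theorem geomReductionMap_tensor_surjective (𝒳 : IntegralModel (valuationSubringAtPrime K v) K X)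
    (𝒴 : IntegralModel (valuationSubringAtPrime K v) K Y) [IsProper 𝒳.total.hom] [IsProper 𝒴.total.hom]
    (h𝒳 : Function.Surjective 𝒳.geomReductionMap) (h𝒴 : Function.Surjective 𝒴.geomReductionMap) :
    Function.Surjective (haveI := isProper_tensor_total 𝒳 𝒴; (𝒳.tensor 𝒴).geomReductionMap) := by
  haveI := isProper_tensor_total 𝒳 𝒴
  intro z
  obtain ⟨x₁, h₁⟩ := h𝒳 (z ≫ (specialFibreFunctor v).map (fst 𝒳.total 𝒴.total))
  obtain ⟨x₂, h₂⟩ := h𝒴 (z ≫ (specialFibreFunctor v).map (snd 𝒳.total 𝒴.total))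
  refine ⟨lift x₁ x₂, ?_⟩
  rw [geomReductionMap_tensor_lift, h₁, h₂]
  exact (CartesianMonoidal.eq_lift_comp_μ (specialFibreFunctor v) z).symm

end IntegralModel

end Literature.AlgebraicGeometry.Motives

end
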